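import Literature.AlgebraicGeometry.Modules.KernelFiniteLocallyFree
import Mathlib.CategoryTheory.Abelian.Subcategory
import Mathlib.CategoryTheory.Preadditive.LeftExact
import HarnessLib

/-!
# Quasi-coherent `𝒪_X`-modules form an abelian full subcategory of `Mod(𝒪_X)` with exact inclusion

The Stacks Project, Tag 01LA (Schemes, Lemma 26.24.1), verbatim: "Let `X` be a scheme. Kernels and
cokernels of maps of quasi-coherent modules are quasi-coherent modules. Finite direct sums of
quasi-coherent modules are quasi-coherent. In particular, the category of quasi-coherent modules on
`X` is abelian and the inclusion functor `QCoh(𝒪_X) → Mod(𝒪_X)` is exact."; Hartshorne, *Algebraic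
Geometry*, II Prop. 5.7 ("The kernel, cokernel, and image of any morphism of quasi-coherent sheaves
are quasi-coherent"); Görtz–Wedhorn I, Cor. 7.19.

This file assembles that statement for Mathlib's abelian category `X.Modules` of ALL sheaves of
`𝒪_X`-modules on a scheme `X`, packaging quasi-coherence as an `ObjectProperty` so that Mathlib's
`CategoryTheory/Abelian/Subcategory.lean` (`ContainsZero`, `IsClosedUnderKernels`, `IsClosedUnderCokernels`,
`IsClosedUnderFiniteProducts` ⇒ `Abelian P.FullSubcategory`) applies, and it identifies the two
quasi-coherence predicates of the tree: the SECTION-LEVEL `IsAffineLocalizing M` (`Modules/AffineLocalizing`: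
numerators and torsion on the principal opens of every affine open — EGA I Thm. 1.4.1 d1), d2), Hartshorne
II Lemma 5.3; closure under kernels, quotients, extensions in `Modules/AffineLocalizingClosure`) and Mathlib's
`SheafOfModules.IsQuasicoherent M` (local presentations). Everything PROVED; no named facts:

* `IsAffineLocalizing.of_isZero`, `.cokernel` (of an ARBITRARY morphism: image factorisation and
  `of_shortExact₃` twice), `.biprod`, `.prod` — the closure statements of Tag 01LA not yet in the tree;
* `isAffineLocalizing X : ObjectProperty X.Modules` with instances `ContainsZero`, `IsClosedUnderIsomorphisms`,
  `IsClosedUnderKernels`, `IsClosedUnderCokernels`, `IsClosedUnderBinaryProducts`, `IsClosedUnderFiniteProducts`;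
  hence **`Abelian (isAffineLocalizing X).FullSubcategory`** and the EXACT inclusion `(isAffineLocalizing X).ι`
  (`PreservesFiniteLimits`, `PreservesFiniteColimits`);
* `isQuasicoherent_of_isAffineLocalizing` (converse of the tree's `IsAffineLocalizing.of_isQuasicoherent`:
  on an affine open `V`, `M|_{Spec Γ(V)} ≅ Γ(V, M)~` (Mathlib `isIso_fromTildeΓ_iff_isLocalizing`) is
  presented; transport to the over-site of `V`, glue by `IsQuasicoherent.of_coversTop`),
  `isQuasicoherent_iff_isAffineLocalizing`, **`isAffineLocalizing_eq_isQuasicoherent`**, and the same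
  instances, abelianness and exactness for Mathlib's predicate `SheafOfModules.isQuasicoherent X.ringCatSheaf`.

Motivation: block (Q1a) of the route-Q construction of the derived adjoint pair `g^* ⊣ Rg_*` of an
isogeny (cell pub-hodge-ring2): an abelian `QCoh(X)` with exact inclusion into `Mod(𝒪_X)`, on which
`g_*` (affine `g`) and `g^*` (flat `g`) restrict to exact functors.

## References

* The Stacks Project, Tag 01LA (Lemma 26.24.1). [StacksProject]
* R. Hartshorne, *Algebraic Geometry*, GTM 52 (1977), II Prop. 5.4, Cor. 5.5, Prop. 5.7 (pp. 113–114). [Hartshorne1977]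
* U. Görtz, T. Wedhorn, *Algebraic Geometry I*, 2nd ed. (2020), Cor. 7.19. [GortzWedhorn2020]

Mathlib searched (pin v4.32): `ObjectProperty.{ContainsZero, IsClosedUnderKernels, IsClosedUnderCokernels,
IsClosedUnderFiniteProducts}`, `Abelian/Subcategory.lean`, `ObjectProperty.preservesKernels_ι`/`preservesCokernels_ι`,
`Functor.preservesFiniteLimits_of_preservesKernels`/`…Colimits_of_preservesCokernels`, `SheafOfModules.isQuasicoherent`,
`isQuasicoherent_iff_isIso_fromTildeΓ`, `presentationTilde`, `Presentation.map`/`ofIsIso`/`isQuasicoherent`,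
`IsQuasicoherent.of_coversTop`, `Scheme.Modules.overFunctorEquiv`; Mathlib has no closure statement for
quasi-coherence under kernels or cokernels on a scheme.
-/

noncomputable section

-- `TopCat.Presheaf`/`Scheme.Modules` are not reducible (as in Mathlib's `AlgebraicGeometry/Modules/Sheaf.lean`).
set_option backward.isDefEq.respectTransparency false

open CategoryTheory CategoryTheory.Limits AlgebraicGeometry TopologicalSpace Opposite

universe u

namespace Literature.AlgebraicGeometry.Modules

variable {X : Scheme.{u}}

/-! ## The remaining closure properties of affine-localizing modules (Stacks 01LA) -/

namespace IsAffineLocalizing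

/-- A zero `𝒪_X`-module is affine-localizing (it is the kernel of the identity of the structure
sheaf, an affine-localizing module; Stacks 01LA: finite direct sums — in particular the empty one — of
quasi-coherent modules are quasi-coherent). [cite: StacksProject, Tag 01LA] -/
theorem of_isZero {M : X.Modules} (hM : IsZero M) : IsAffineLocalizing M :=
  of_iso ((isZero_kernel_of_mono (𝟙 (SheafOfModules.unit X.ringCatSheaf))).iso hM)
    (IsAffineLocalizing.unit.kernel (𝟙 _) IsAffineLocalizing.unit)

/-- **The cokernel of a morphism between affine-localizing modules is affine-localizing**
(Stacks 01LA; Hartshorne II Prop. 5.7: cokernels and images of quasi-coherent sheaves are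
quasi-coherent). Proof: the coimage `M / ker φ` is a quotient of `M` by the affine-localizing `ker φ`
(`of_shortExact₃`), it is the image `ker (coker φ)` (`Abelian.coimageIsoImage`), and `coker φ` is the
quotient of `N` by it (`of_shortExact₃` again). [cite: StacksProject, Tag 01LA] -/
theorem cokernel {M N : X.Modules} (φ : M ⟶ N) (hM : IsAffineLocalizing M)
    (hN : IsAffineLocalizing N) : IsAffineLocalizing (Limits.cokernel φ) := by
  -- the coimage `cokernel (kernel.ι φ)` is a quotient of `M` by the affine-localizing kernel
  have hK : IsAffineLocalizing (Limits.kernel φ) := hM.kernel φ hN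
  have hS₁ : (ShortComplex.cokernelSequence (kernel.ι φ)).ShortExact :=
    ShortComplex.ShortExact.mk' (ShortComplex.cokernelSequence_exact _)
      (by dsimp [ShortComplex.cokernelSequence]; infer_instance) inferInstance
  have hcoim : IsAffineLocalizing (Abelian.coimage φ) := of_shortExact₃ hS₁ hK hM
  -- hence the image `kernel (cokernel.π φ)` is affine-localizing
  have himg : IsAffineLocalizing (Abelian.image φ) := of_iso (Abelian.coimageIsoImage φ) hcoim
  -- and `cokernel φ` is the quotient of `N` by the image
  have hS₂ : (ShortComplex.kernelSequence (cokernel.π φ)).ShortExact :=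
    ShortComplex.ShortExact.mk' (ShortComplex.kernelSequence_exact _) inferInstance
      (by dsimp [ShortComplex.kernelSequence]; infer_instance)
  exact of_shortExact₃ hS₂ himg hN

/-- **The binary biproduct of affine-localizing modules is affine-localizing** (Stacks 01LA:
finite direct sums of quasi-coherent modules are quasi-coherent): `M ⊞ N` is the (split) extension
of `N` by `M` (`of_shortExact₂`). [cite: StacksProject, Tag 01LA] -/
theorem biprod {M N : X.Modules} (hM : IsAffineLocalizing M) (hN : IsAffineLocalizing N) :
    IsAffineLocalizing (M ⊞ N) :=
  of_shortExact₂ (ShortComplex.Splitting.ofHasBinaryBiproduct M N).shortExact hM hN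

/-- The binary product of affine-localizing modules is affine-localizing (`M ⨯ N ≅ M ⊞ N`).
[cite: StacksProject, Tag 01LA] -/
theorem prod {M N : X.Modules} (hM : IsAffineLocalizing M) (hN : IsAffineLocalizing N) :
    IsAffineLocalizing (M ⨯ N) :=
  of_iso (biprod.isoProd M N) (hM.biprod hN)

end IsAffineLocalizing

/-! ## Quasi-coherent modules as an `ObjectProperty`: an abelian full subcategory, exact inclusion -/

variable (X) in
/-- **The property "quasi-coherent" of `𝒪_X`-modules**, as an `ObjectProperty X.Modules`, with the
tree's section-level predicate `IsAffineLocalizing` (EGA I Thm. 1.4.1 d1), d2); Hartshorne II Lemma 5.3)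
as its definition; it EQUALS Mathlib's `SheafOfModules.isQuasicoherent X.ringCatSheaf`
(`isAffineLocalizing_eq_isQuasicoherent`). Its full subcategory `(isAffineLocalizing X).FullSubcategory`
is the category `QCoh(X)`. [cite: StacksProject, Tag 01LA] -/
def isAffineLocalizing : ObjectProperty X.Modules := fun M => IsAffineLocalizing M

/-- Membership in `isAffineLocalizing X` is `IsAffineLocalizing` (EGA I Thm. 1.4.1 d1), d2) = Hartshorne II
Lemma 5.3 / Prop. 5.4 as the definition of quasi-coherence). [cite: Hartshorne1977, II Prop. 5.4 (p. 113)] -/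
@[simp]
theorem isAffineLocalizing_iff (M : X.Modules) : isAffineLocalizing X M ↔ IsAffineLocalizing M :=
  Iff.rfl

/-- `QCoh(X)` is closed under isomorphisms in `Mod(𝒪_X)`. [folklore] -/
instance isAffineLocalizing_isClosedUnderIsomorphisms :
    (isAffineLocalizing X).IsClosedUnderIsomorphisms where
  of_iso e hM := IsAffineLocalizing.of_iso e hM

/-- `QCoh(X)` contains the zero module. [folklore] -/
instance isAffineLocalizing_containsZero : (isAffineLocalizing X).ContainsZero where
  exists_zero := ⟨_, isZero_zero X.Modules, IsAffineLocalizing.of_isZero (isZero_zero _)⟩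

/-- **`QCoh(X)` is closed under kernels** in `Mod(𝒪_X)` (Stacks 01LA). [cite: StacksProject, Tag 01LA] -/
instance isAffineLocalizing_isClosedUnderKernels : (isAffineLocalizing X).IsClosedUnderKernels where
  kernels_le := by
    rintro _ ⟨f, k, hk, hf⟩
    exact (isAffineLocalizing X).prop_of_iso
      (IsLimit.conePointUniqueUpToIso (kernelIsKernel f) hk)
      (IsAffineLocalizing.kernel f hf.1 hf.2)

/-- **`QCoh(X)` is closed under cokernels** in `Mod(𝒪_X)` (Stacks 01LA). [cite: StacksProject, Tag 01LA] -/
instance isAffineLocalizing_isClosedUnderCokernels :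
    (isAffineLocalizing X).IsClosedUnderCokernels where
  cokernels_le := by
    rintro _ ⟨f, k, hk, hf⟩
    exact (isAffineLocalizing X).prop_of_iso
      (IsColimit.coconePointUniqueUpToIso (cokernelIsCokernel f) hk)
      (IsAffineLocalizing.cokernel f hf.1 hf.2)

/-- **`QCoh(X)` is closed under binary products** in `Mod(𝒪_X)` (Stacks 01LA: finite direct sums).
[cite: StacksProject, Tag 01LA] -/
instance isAffineLocalizing_isClosedUnderBinaryProducts :
    (isAffineLocalizing X).IsClosedUnderBinaryProducts :=
  ObjectProperty.IsClosedUnderLimitsOfShape.mk' (by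
    rintro _ ⟨F, hF⟩
    exact (isAffineLocalizing X).prop_of_iso (HasLimit.isoOfNatIso (diagramIsoPair F)).symm
      (IsAffineLocalizing.prod (hF ⟨WalkingPair.left⟩) (hF ⟨WalkingPair.right⟩)))

/-- **`QCoh(X)` is closed under finite products** in `Mod(𝒪_X)` (Stacks 01LA).
[cite: StacksProject, Tag 01LA] -/
instance isAffineLocalizing_isClosedUnderFiniteProducts :
    (isAffineLocalizing X).IsClosedUnderFiniteProducts :=
  ObjectProperty.IsClosedUnderFiniteProducts.mk'

/-- **`QCoh(X)` is an abelian category** (Stacks 01LA: "the category of quasi-coherent modules on `X`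
is abelian") — Mathlib's `Abelian P.FullSubcategory` for an object property containing zero and closed
under kernels, cokernels and finite products. [cite: StacksProject, Tag 01LA] -/
instance abelian_isAffineLocalizing : Abelian (isAffineLocalizing X).FullSubcategory :=
  inferInstance

/-- The inclusion `QCoh(X) ⥤ Mod(𝒪_X)` is additive. [folklore] -/
instance isAffineLocalizing_ι_additive : (isAffineLocalizing X).ι.Additive where

/-- **The inclusion `QCoh(X) ⥤ Mod(𝒪_X)` is left exact** (it preserves kernels, Mathlib
`ObjectProperty.preservesKernels_ι`, hence all finite limits). [cite: StacksProject, Tag 01LA] -/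
instance preservesFiniteLimits_isAffineLocalizing_ι :
    PreservesFiniteLimits (isAffineLocalizing X).ι :=
  haveI : ∀ {A B : (isAffineLocalizing X).FullSubcategory} (f : A ⟶ B),
      PreservesLimit (parallelPair f 0) (isAffineLocalizing X).ι :=
    fun f => (isAffineLocalizing X).preservesKernels_ι f
  (isAffineLocalizing X).ι.preservesFiniteLimits_of_preservesKernels

/-- **The inclusion `QCoh(X) ⥤ Mod(𝒪_X)` is right exact** (it preserves cokernels, Mathlib
`ObjectProperty.preservesCokernels_ι`, hence all finite colimits). [cite: StacksProject, Tag 01LA] -/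
instance preservesFiniteColimits_isAffineLocalizing_ι :
    PreservesFiniteColimits (isAffineLocalizing X).ι :=
  haveI : ∀ {A B : (isAffineLocalizing X).FullSubcategory} (f : A ⟶ B),
      PreservesColimit (parallelPair f 0) (isAffineLocalizing X).ι :=
    fun f => (isAffineLocalizing X).preservesCokernels_ι f
  (isAffineLocalizing X).ι.preservesFiniteColimits_of_preservesCokernels

/-! ## The two quasi-coherence predicates agree: `IsAffineLocalizing M ↔ M.IsQuasicoherent` -/

section Bridge

open SheafOfModules

/-- For `M` affine-localizing and `V ⊆ X` an affine open, the restriction `M|_{Spec Γ(X,V)}` is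
quasi-coherent in Mathlib's sense: it is localizing (`isLocalizing_restrict_fromSpec`), i.e.
`Γ(V, M)~ ≅ M|_{Spec Γ(X,V)}` (Mathlib `isIso_fromTildeΓ_iff_isLocalizing`, Hartshorne II Cor. 5.5).
[cite: Hartshorne1977, II Cor. 5.5 (p. 113)] -/
theorem IsAffineLocalizing.isQuasicoherent_restrict_fromSpec {M : X.Modules}
    (hM : IsAffineLocalizing M) {V : X.Opens} (hV : IsAffineOpen V) :
    (M.restrict hV.fromSpec).IsQuasicoherent :=
  (isQuasicoherent_iff_isIso_fromTildeΓ _).mpr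
    ((isIso_fromTildeΓ_iff_isLocalizing _).mpr (isLocalizing_restrict_fromSpec M hM hV))

/-- For `M` affine-localizing and `V ⊆ X` an affine open, `M.over V` (on the over-site of `V`) is
quasi-coherent in Mathlib's sense: the global presentation of `M|_{Spec Γ(X,V)} ≅ Γ(V, M)~` (Mathlib
`presentationTilde`) is transported (Mathlib `Presentation.map`) along (restriction along `V ≅ Spec Γ(X,V)`)
`⋙` (inverse of `Scheme.Modules.overEquiv V`), a colimit-preserving functor sending `𝒪` to `𝒪` under which
`M|_{Spec Γ(X,V)}` becomes `M.over V` (Mathlib `overFunctorEquiv`) — the transport of the tree's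
`Motives.nonempty_free_iso_over_of_free_iso_restrict`. [cite: Hartshorne1977, II Cor. 5.5 (p. 113)] -/
theorem IsAffineLocalizing.isQuasicoherent_over {M : X.Modules} (hM : IsAffineLocalizing M)
    {V : X.Opens} (hV : IsAffineOpen V) : (M.over V).IsQuasicoherent := by
  haveI : IsIso (M.restrict hV.fromSpec).fromTildeΓ :=
    (isIso_fromTildeΓ_iff_isLocalizing _).mpr (isLocalizing_restrict_fromSpec M hM hV)
  -- a global presentation of `M|_{Spec Γ(X,V)} ≅ Γ(V, M)~`
  let P₀ : (M.restrict hV.fromSpec).Presentation :=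
    Presentation.ofIsIso (M.restrict hV.fromSpec).fromTildeΓ
      (presentationTilde.{u} _ .univ (by simp) _ (Submodule.span_eq _))
  -- the transport functor to the over-site of `V` and its two compatibilities
  let G : (Spec Γ(X, V)).Modules ⥤ SheafOfModules.{u} (X.ringCatSheaf.over V) :=
    Scheme.Modules.restrictFunctor hV.isoSpec.hom ⋙ (Scheme.Modules.overEquiv V).inverse
  haveI : PreservesColimitsOfSize.{u, u} G := by
    dsimp only [G]
    infer_instance
  let η : SheafOfModules.unit _ ≅ G.obj (SheafOfModules.unit _) :=
    (TopologicalSpace.Opens.sheafOfModulesEquivOverInverseUnit V X.ringCatSheaf).symm ≪≫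
      (Scheme.Modules.overEquiv V).inverse.mapIso
        (Scheme.Modules.restrictUnitIso hV.isoSpec.hom).symm
  -- restricting along `V ≅ Spec Γ(X, V)` and back is the identity
  let ρ : Scheme.Modules.restrictFunctor hV.isoSpec.inv ⋙
      Scheme.Modules.restrictFunctor hV.isoSpec.hom ≅ 𝟭 _ :=
    (Scheme.Modules.restrictFunctorComp hV.isoSpec.hom hV.isoSpec.inv).symm ≪≫
      Scheme.Modules.restrictFunctorCongr hV.isoSpec.hom_inv_id ≪≫ Scheme.Modules.restrictFunctorId
  let θ : M.over V ≅ G.obj (M.restrict hV.fromSpec) :=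
    (Scheme.Modules.overEquiv V).unitIso.app (M.over V) ≪≫
      (Scheme.Modules.overEquiv V).inverse.mapIso
        ((Scheme.Modules.overFunctorEquiv V).app M ≪≫ ρ.symm.app (M.restrict V.ι) ≪≫
          (Scheme.Modules.restrictFunctor hV.isoSpec.hom).mapIso
            ((Scheme.Modules.restrictFunctorComp hV.isoSpec.inv V.ι).app M).symm)
  exact (Presentation.ofIsIso θ.inv (P₀.map G η)).isQuasicoherent

/-- The affine opens of a scheme cover it, as a `CoversTop` family for the Zariski topology on
`X.Opens`. [folklore] -/
private theorem coversTop_affineOpens (X : Scheme.{u}) :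
    (Opens.grothendieckTopology X).CoversTop (fun V : X.affineOpens => (V : X.Opens)) :=
  (Opens.coversTop_iff _ _).mpr (TopologicalSpace.IsOpenCover.mk (iSup_affineOpens_eq_top X))

/-- **An affine-localizing `𝒪_X`-module is quasi-coherent in Mathlib's sense** (EGA I Thm. 1.4.1 d1), d2);
Hartshorne II Prop. 5.4 / Cor. 5.5: `𝓕` is quasi-coherent iff `𝓕|_V ≅ Γ(V, 𝓕)~` on the affine opens):
quasi-coherence is local (Mathlib `IsQuasicoherent.of_coversTop`) and holds on every affine open
(`isQuasicoherent_over`); the converse is the tree's `IsAffineLocalizing.of_isQuasicoherent`.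
[cite: Hartshorne1977, II Prop. 5.4 (p. 113)] -/
theorem isQuasicoherent_of_isAffineLocalizing {M : X.Modules} (hM : IsAffineLocalizing M) :
    M.IsQuasicoherent :=
  haveI : ∀ V : X.affineOpens,
      (M.over ((fun V : X.affineOpens => (V : X.Opens)) V)).IsQuasicoherent :=
    fun V => hM.isQuasicoherent_over V.2
  IsQuasicoherent.of_coversTop M (fun V : X.affineOpens => (V : X.Opens)) (coversTop_affineOpens X)

/-- **The two quasi-coherence predicates agree**: Mathlib's `SheafOfModules.IsQuasicoherent` (local
presentations) `↔` the tree's `IsAffineLocalizing` (numerators and torsion on principal opens of affine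
opens; EGA I Thm. 1.4.1 d1), d2), Hartshorne II Lemma 5.3 / Prop. 5.4).
[cite: Hartshorne1977, II Prop. 5.4 (p. 113)] -/
theorem isQuasicoherent_iff_isAffineLocalizing (M : X.Modules) :
    M.IsQuasicoherent ↔ IsAffineLocalizing M :=
  ⟨fun _ => IsAffineLocalizing.of_isQuasicoherent M, isQuasicoherent_of_isAffineLocalizing⟩

/-- **`isAffineLocalizing X = SheafOfModules.isQuasicoherent X.ringCatSheaf`** as object properties
of `X.Modules`: the full subcategory `QCoh(X)` is the same whichever predicate is used.
[cite: Hartshorne1977, II Prop. 5.4 (p. 113)] -/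
theorem isAffineLocalizing_eq_isQuasicoherent :
    isAffineLocalizing X = SheafOfModules.isQuasicoherent X.ringCatSheaf := by
  funext M
  exact propext (isQuasicoherent_iff_isAffineLocalizing M).symm

end Bridge

/-! ## The same structure for Mathlib's predicate `SheafOfModules.isQuasicoherent` -/

section MathlibPredicate

/-- `QCoh(X)` (Mathlib's predicate) contains the zero module. [folklore] -/
instance isQuasicoherent_containsZero :
    (SheafOfModules.isQuasicoherent X.ringCatSheaf).ContainsZero where
  exists_zero := ⟨_, isZero_zero X.Modules,
    isQuasicoherent_of_isAffineLocalizing (IsAffineLocalizing.of_isZero (isZero_zero _))⟩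

/-- **Kernels of maps of quasi-coherent `𝒪_X`-modules are quasi-coherent** (Stacks 01LA), for
Mathlib's `SheafOfModules.IsQuasicoherent`. [cite: StacksProject, Tag 01LA] -/
instance isQuasicoherent_isClosedUnderKernels :
    (SheafOfModules.isQuasicoherent X.ringCatSheaf).IsClosedUnderKernels where
  kernels_le := by
    rintro _ ⟨f, k, hk, hf⟩
    haveI := hf.1
    haveI := hf.2
    exact (SheafOfModules.isQuasicoherent X.ringCatSheaf).prop_of_iso
      (IsLimit.conePointUniqueUpToIso (kernelIsKernel f) hk)
      (isQuasicoherent_of_isAffineLocalizing (IsAffineLocalizing.kernel f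
        (IsAffineLocalizing.of_isQuasicoherent _) (IsAffineLocalizing.of_isQuasicoherent _)))

/-- **Cokernels of maps of quasi-coherent `𝒪_X`-modules are quasi-coherent** (Stacks 01LA), for
Mathlib's `SheafOfModules.IsQuasicoherent`. [cite: StacksProject, Tag 01LA] -/
instance isQuasicoherent_isClosedUnderCokernels :
    (SheafOfModules.isQuasicoherent X.ringCatSheaf).IsClosedUnderCokernels where
  cokernels_le := by
    rintro _ ⟨f, k, hk, hf⟩
    haveI := hf.1
    haveI := hf.2
    exact (SheafOfModules.isQuasicoherent X.ringCatSheaf).prop_of_iso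
      (IsColimit.coconePointUniqueUpToIso (cokernelIsCokernel f) hk)
      (isQuasicoherent_of_isAffineLocalizing (IsAffineLocalizing.cokernel f
        (IsAffineLocalizing.of_isQuasicoherent _) (IsAffineLocalizing.of_isQuasicoherent _)))

/-- **Binary products of quasi-coherent `𝒪_X`-modules are quasi-coherent** (Stacks 01LA), for Mathlib's
`SheafOfModules.IsQuasicoherent`. [cite: StacksProject, Tag 01LA] -/
instance isQuasicoherent_isClosedUnderBinaryProducts :
    (SheafOfModules.isQuasicoherent X.ringCatSheaf).IsClosedUnderBinaryProducts :=
  ObjectProperty.IsClosedUnderLimitsOfShape.mk' (by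
    rintro _ ⟨F, hF⟩
    haveI := hF ⟨WalkingPair.left⟩
    haveI := hF ⟨WalkingPair.right⟩
    exact (SheafOfModules.isQuasicoherent X.ringCatSheaf).prop_of_iso
      (HasLimit.isoOfNatIso (diagramIsoPair F)).symm
      (isQuasicoherent_of_isAffineLocalizing (IsAffineLocalizing.prod
        (IsAffineLocalizing.of_isQuasicoherent (F.obj ⟨WalkingPair.left⟩))
        (IsAffineLocalizing.of_isQuasicoherent (F.obj ⟨WalkingPair.right⟩)))))

/-- **Finite products of quasi-coherent `𝒪_X`-modules are quasi-coherent** (Stacks 01LA), for Mathlib's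
`SheafOfModules.IsQuasicoherent`. [cite: StacksProject, Tag 01LA] -/
instance isQuasicoherent_isClosedUnderFiniteProducts :
    (SheafOfModules.isQuasicoherent X.ringCatSheaf).IsClosedUnderFiniteProducts :=
  ObjectProperty.IsClosedUnderFiniteProducts.mk'

/-- **The category `QCoh(X)` of quasi-coherent `𝒪_X`-modules (Mathlib's predicate) is abelian**
(Stacks 01LA). [cite: StacksProject, Tag 01LA] -/
instance abelian_isQuasicoherent :
    Abelian (SheafOfModules.isQuasicoherent X.ringCatSheaf).FullSubcategory :=
  inferInstance

/-- The inclusion `QCoh(X) ⥤ Mod(𝒪_X)` (Mathlib's predicate) is additive. [folklore] -/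
instance isQuasicoherent_ι_additive : (SheafOfModules.isQuasicoherent X.ringCatSheaf).ι.Additive where

/-- **The inclusion `QCoh(X) ⥤ Mod(𝒪_X)` is left exact** (Stacks 01LA: "the inclusion functor
`QCoh(𝒪_X) → Mod(𝒪_X)` is exact"), for Mathlib's predicate. [cite: StacksProject, Tag 01LA] -/
instance preservesFiniteLimits_isQuasicoherent_ι :
    PreservesFiniteLimits (SheafOfModules.isQuasicoherent X.ringCatSheaf).ι :=
  haveI : ∀ {A B : (SheafOfModules.isQuasicoherent X.ringCatSheaf).FullSubcategory} (f : A ⟶ B),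
      PreservesLimit (parallelPair f 0) (SheafOfModules.isQuasicoherent X.ringCatSheaf).ι :=
    fun f => (SheafOfModules.isQuasicoherent X.ringCatSheaf).preservesKernels_ι f
  (SheafOfModules.isQuasicoherent X.ringCatSheaf).ι.preservesFiniteLimits_of_preservesKernels

/-- **The inclusion `QCoh(X) ⥤ Mod(𝒪_X)` is right exact** (Stacks 01LA), for Mathlib's predicate.
[cite: StacksProject, Tag 01LA] -/
instance preservesFiniteColimits_isQuasicoherent_ι :
    PreservesFiniteColimits (SheafOfModules.isQuasicoherent X.ringCatSheaf).ι :=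
  haveI : ∀ {A B : (SheafOfModules.isQuasicoherent X.ringCatSheaf).FullSubcategory} (f : A ⟶ B),
      PreservesColimit (parallelPair f 0) (SheafOfModules.isQuasicoherent X.ringCatSheaf).ι :=
    fun f => (SheafOfModules.isQuasicoherent X.ringCatSheaf).preservesCokernels_ι f
  (SheafOfModules.isQuasicoherent X.ringCatSheaf).ι.preservesFiniteColimits_of_preservesCokernels

/-- **Stacks 01LA for Mathlib's predicate, elementwise**: the kernel of a morphism of quasi-coherent
`𝒪_X`-modules is quasi-coherent. [cite: StacksProject, Tag 01LA] -/
theorem isQuasicoherent_kernel {M N : X.Modules} (φ : M ⟶ N) [M.IsQuasicoherent] [N.IsQuasicoherent] :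
    (Limits.kernel φ).IsQuasicoherent :=
  (SheafOfModules.isQuasicoherent X.ringCatSheaf).prop_kernel φ ‹_› ‹_›

/-- **Stacks 01LA, elementwise**: cokernels of maps of quasi-coherent modules are quasi-coherent. [cite: StacksProject, Tag 01LA] -/
theorem isQuasicoherent_cokernel {M N : X.Modules} (φ : M ⟶ N) [M.IsQuasicoherent]
    [N.IsQuasicoherent] : (Limits.cokernel φ).IsQuasicoherent :=
  (SheafOfModules.isQuasicoherent X.ringCatSheaf).prop_cokernel φ ‹_› ‹_›

/-- **Stacks 01LA, elementwise**: `M ⊞ N` of quasi-coherent modules is quasi-coherent. [cite: StacksProject, Tag 01LA] -/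
theorem isQuasicoherent_biprod (M N : X.Modules) [M.IsQuasicoherent] [N.IsQuasicoherent] :
    (M ⊞ N).IsQuasicoherent :=
  (isQuasicoherent_iff_isAffineLocalizing _).mpr
    ((IsAffineLocalizing.of_isQuasicoherent M).biprod (IsAffineLocalizing.of_isQuasicoherent N))

/-- **Stacks 01LA for Mathlib's predicate, elementwise**: in a short exact sequence `0 → M' → M → M'' → 0`
of `𝒪_X`-modules with `M'`, `M''` quasi-coherent, `M` is quasi-coherent (extensions). [cite: StacksProject, Tag 01LA] -/
theorem isQuasicoherent_of_shortExact {S : ShortComplex X.Modules} (hS : S.ShortExact)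
    [S.X₁.IsQuasicoherent] [S.X₃.IsQuasicoherent] : S.X₂.IsQuasicoherent :=
  (isQuasicoherent_iff_isAffineLocalizing _).mpr
    (IsAffineLocalizing.of_shortExact₂ hS (IsAffineLocalizing.of_isQuasicoherent _)
      (IsAffineLocalizing.of_isQuasicoherent _))

end MathlibPredicate

end Literature.AlgebraicGeometry.Modules

end
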